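import Literature.AlgebraicGeometry.ShimuraVarieties.UnitaryShimuraCanonicalModel
import Literature.NumberTheory.GaloisRepresentations.NormResidueSymbolIdentityComponent
import HarnessLib

/-!
# Every automorphism of `ℂ` over `τ(L)` has an Artin-correspondent finite idèle

Sibling of `UnitaryShimuraCanonicalModel` (htheta-x1) and `UnitaryShimuraCanonicalModelNonVacuity`: the
hypothesis `IsArtinCorrespondent L τ s σ` of the reciprocity clause (F3) («`art_L(s) = σ|_{L^{ab}}`»,
[Milne 2005] (59), Def. 12.8 (62)) is satisfiable for EVERY `σ ∈ Aut(ℂ/τL)`: restricting `σ` along an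
`L`-embedding `e : L̄ → ℂ` gives `γ ∈ Gal(L̄/L)` (Mathlib `AlgHom.restrictNormal'`, `L̄/L` normal), and
since `L` is totally complex every class of `Gal(L̄/L)^{ab}` is `θ_L` of the class of a FINITE idèle
(the archimedean idèles lie in the identity component, which dies under the norm-residue symbol —
lit-deligne's `exists_finiteIdele_absGaloisAbProj_eq_theta_inv`, Milne p. 107).  So the `∀ σ s,
IsArtinCorrespondent … →` of `Record.recip` constrains the Galois action of every `σ`, as [Milne 2005]
Def. 12.8 intends («every automorphism `σ` of `ℂ` fixing `E(x)` acts on `[x,a]_K` according to (62)»).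
THEOREMS ONLY.  (Cells pub-hodgecm / pub-hodgecm2: vacuity pass of the S2 canonical-model record,
binder-2 g24.)

## References
* [Milne2005ShimuraVarieties] J. S. Milne, *Introduction to Shimura varieties* (2005), p. 107 and (59);
  Def. 12.8 (62) p. 114.
* [Deligne1979ShimuraVarieties] P. Deligne, *Variétés de Shimura* (1979), 0.8, 2.2.3–2.2.4.
-/

set_option autoImplicit false

noncomputable section

open Function NumberField IsDedekindDomain
open Literature.NumberTheory.GaloisRepresentations

namespace Literature.AlgebraicGeometry.ShimuraVarieties

namespace UnitaryCanonicalModel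

variable (L : Type) [Field L] [NumberField L] [IsCMField L]

omit [NumberField L] [IsCMField L] in
/-- **Restriction of `σ ∈ Aut(ℂ/τL)` to the algebraic closure**: for a ring automorphism `σ` of `ℂ`
fixing `τ(L)` pointwise there are an `L`-embedding `e : L̄ → ℂ` (along `τ`) and `γ ∈ Gal(L̄/L)` with
`e ∘ γ = σ ∘ e` (`L̄/L` is normal, so `σ ∘ e` and `e` have the same image; Mathlib
`AlgHom.restrictNormal'`, Stacks 0BME). [cite: StacksProject, Tag 0BME]
[cite: Milne2005ShimuraVarieties, p. 107 L9–15] -/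
theorem exists_absoluteGaloisGroup_restrict (τ : L →+* ℂ) (σ : ℂ ≃+* ℂ) (hσ : ∀ x : L, σ (τ x) = τ x) :
    letI : Algebra L ℂ := τ.toAlgebra
    ∃ (e : AlgebraicClosure L →ₐ[L] ℂ) (γ : Field.absoluteGaloisGroup L),
      ∀ x : AlgebraicClosure L, e (Field.absoluteGaloisGroup.toAlgEquiv L γ x) = σ (e x) := by
  letI : Algebra L ℂ := τ.toAlgebra
  let σₐ : ℂ ≃ₐ[L] ℂ := AlgEquiv.ofRingEquiv (f := σ) fun x => hσ x
  let e : AlgebraicClosure L →ₐ[L] ℂ := IsAlgClosed.lift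
  letI : Algebra (AlgebraicClosure L) ℂ := e.toRingHom.toAlgebra
  haveI : IsScalarTower L (AlgebraicClosure L) ℂ :=
    IsScalarTower.of_algebraMap_eq fun x => (e.commutes x).symm
  refine ⟨e, (σₐ : ℂ →ₐ[L] ℂ).restrictNormal' (AlgebraicClosure L), fun x => ?_⟩
  have h := AlgHom.restrictNormal_commutes (σₐ : ℂ →ₐ[L] ℂ) (AlgebraicClosure L) x
  exact h

/-- **Every `σ ∈ Aut(ℂ/τL)` has an Artin-correspondent FINITE idèle** (`L` CM, hence totally complex):
there is `s ∈ 𝔸_{L,f}^×` with `IsArtinCorrespondent L τ s σ`, i.e. `art_L(s) = σ|_{L^{ab}}` in the sense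
of the record (`[γ_σ] = θ_L((1_∞, s))⁻¹`).  Galois half: `exists_absoluteGaloisGroup_restrict`; idèle half:
`exists_finiteIdele_absGaloisAbProj_eq_theta_inv` (θ_L onto, archimedean idèles in the identity
component). [cite: Milne2005ShimuraVarieties, p. 107 L9–15 and (59); Def. 12.8 (62) p. 114]
[cite: Deligne1979ShimuraVarieties, 0.8 and 2.2.3] -/
theorem exists_finiteIdele_isArtinCorrespondent (τ : L →+* ℂ) (σ : ℂ ≃+* ℂ)
    (hσ : ∀ x : L, σ (τ x) = τ x) :
    ∃ s : (FiniteAdeleRing (𝓞 L) L)ˣ, IsArtinCorrespondent L τ s σ := by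
  obtain ⟨e, γ, he⟩ := exists_absoluteGaloisGroup_restrict L τ σ hσ
  obtain ⟨s, hs⟩ := exists_finiteIdele_absGaloisAbProj_eq_theta_inv (K := L) γ
  exact ⟨s, e, γ, he, hs⟩

/-- The `L`-algebra automorphisms of `ℂ` (for `ℂ` an `L`-algebra through `τ`) fix `τ(L)`; so
`exists_finiteIdele_isArtinCorrespondent` applies to every `σ : ℂ ≃ₐ[L] ℂ` of `Record.recip`: the
hypothesis «`s ∈ 𝔸_{E(x)}^×` with `art_{E(x)}(s) = σ`» of [Milne 2005] Def. 12.8 (62) is met by every `σ`.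
[cite: Milne2005ShimuraVarieties, Def. 12.8 (62) p. 114] -/
theorem exists_finiteIdele_isArtinCorrespondent_algEquiv (τ : L →+* ℂ)
    (σ : letI : Algebra L ℂ := τ.toAlgebra; ℂ ≃ₐ[L] ℂ) :
    ∃ s : (FiniteAdeleRing (𝓞 L) L)ˣ,
      IsArtinCorrespondent L τ s (letI : Algebra L ℂ := τ.toAlgebra; σ.toRingEquiv) := by
  letI : Algebra L ℂ := τ.toAlgebra
  exact exists_finiteIdele_isArtinCorrespondent L τ σ.toRingEquiv fun x => σ.commutes x

end UnitaryCanonicalModel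

end Literature.AlgebraicGeometry.ShimuraVarieties

end
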